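import Summits.ValiantsHypothesis.ValiantsHypothesis.Theorems.KPlusLogSqLawTridiagonalRealStaticPotentialDefs
import Summits.ValiantsHypothesis.ValiantsHypothesis.Theorems.KPlusLogSqLawTridiagonalRealStatic

/-!
# Route «KPlusLogSqLaw», crux `WeakLifting` (stmt-ValiantsHypothesis-19561) — REAL side of the tridiagonal sector:
# THE CONDITIONAL UPPER ROW — conjecture (P) ⇒ every static definite tridiagonal design has at most `2m − 2` positive zeros

HONEST FRAMING.  Helper (`--supports stmt-ValiantsHypothesis-19561 --as helper`), seat val-sym-lift-p3 (g10), cell `pub-symmetroid`,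
2026-08-27, desk rulings R2278 (B) («type (P) as `PotentialLawP` … and land `PotentialLawP → ∀ static definite tridiagonal designs,
card posRoots ≤ 2m − 2`»; words pre-registered «CONDITIONAL UPPER ROW: (P) ⇒ B m ≤ 2m − 2 (kernel)») and R2314.  This file PROVES AN
IMPLICATION whose hypothesis — the potential law (P), `…StaticTridiagonalRealPotential.PotentialLawP` (an `@[conjecture]`, located on
≈ 4·10³ adversarial instances, memo HIERARCHICAL-LIMIT-GAME-liftp3g9.md §7b) — is OPEN.  It proves NO upper law; the α register does not
move.  What it buys: the α register's upper side («is `Z ≤ 2m − 2` on the whole static definite tridiagonal sector?», matching the located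
pump-and-harvest floor `2m − 6` in slope and the Cameron–Psarrakos `α = 2` ceiling candidate `2m`) REDUCES to the local three-continuant
statement (P), and every kernel instance `PotentialStep k` becomes a rung (bounded form `card_posRoots_le_of_potentialSteps`).

WHAT IS PROVED (ns `…KPlusLogSqLaw.StaticTridiagonalRealPotential`; `D_k = pathDet a d b f k`, the continuant currency of the Defs file):
* §1 `count_le_theta`: `#q(w) ≤ Θ(w)` (constant labeling); `theta_nil`.
* §2 `count_true_rootWord`, `card_posRoots_le_count_true`: for `P · Q ≠ 0` the distinct positive roots of `Q` number at most the
  `q`-letters of `rootWord P Q` (= `Σ` over the positive roots of `P · Q` of `rootMultiplicity · Q`); `rootWord_eq_nil`; `card_posRoots_mul_le`.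
* §3 the continuant currency: `pathDet_zero/one/add_two` (three-term recurrence via the tree's `det_ctPath`), `pathDet_congr`,
  `ctK_mul_shift` / `pathDet_split` (a ZERO LINK splits the continuant: `D_{t+1+n} = D_{t+1} · D⁺_n`, block diagonality),
  `eval_pathDet_succ_ne_zero` (NONZERO links ⇒ consecutive continuants share no positive zero — the recurrence would carry a common zero
  down to `D₀ = 1`), `rootWord_zero_one` (`rootWord D₀ D₁ = []`), the POTENTIAL CHAIN `theta_rootWord_le` (`Θ(rootWord D_k D_{k+1}) ≤ 2k`
  from the steps `(P)_j`, `j + 2 ≤ N`), and `card_posRoots_pathDet_succ_le_of_links` (`card posRoots D_{m+1} ≤ 2m`, the degenerate case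
  `D_m ≡ 0` giving NO positive zero at all).
* §4 `card_posRoots_pathDet_le` (strong induction on the size: zero link ⇒ split ⇒ both parts shorter; else the chain),
  `det_of_eq_pathDet` (a matrix `of (C (c i j) · X ^ (e i j))` with `c`, `e` symmetric and `c = 0` off the band IS the path matrix of its
  diagonal/link data), and the row in the typed currency of the α target of record `staticTridiagonal_definite_posRoots_le` (R2102/R2114):
  **`card_posRoots_le_of_potentialSteps`** (steps `(P)_k`, `k + 2 ≤ m`, suffice for size `m`) and
  **`card_posRoots_le_of_potentialLawP : PotentialLawP → … card posRoots ≤ 2 * m - 2`**, plus the admissible-law form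
  `definiteRow_two_mul_sub_two_of_potentialLawP` (the hypothesis shape of lift-p1 g12's `threeHalves_le_slope`).
Nothing here bears on `WeakLifting` / `TropicalB` (stmt-19771) in their windows, on Conjecture B, on the Door-A registers, on
`MatrixDescartes` (stmt-ValiantsHypothesis-18050) or on VP ≠ VNP.
[this cell's memo HIERARCHICAL-LIMIT-GAME-liftp3g9.md §3b (potential argument) / §7b (conjecture (P)); folklore continuants]
-/

-- `Summit.ValiantsHypothesis.ValiantsHypothesis.…` repeats a component by the D-0017 layout (single-conjunct summit); the name is mandated.
set_option linter.dupNamespace false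
set_option autoImplicit false

namespace Summit.ValiantsHypothesis.ValiantsHypothesis.Theorems.KPlusLogSqLaw

namespace StaticTridiagonalRealPotential

open Polynomial Finset
open Summit.ValiantsHypothesis.ValiantsHypothesis.Theorems.ValuativeFlip (ctPath ctK ctPath_apply ctK_zero ctK_one ctK_add_two ctK_congr)
open Summit.ValiantsHypothesis.ValiantsHypothesis.Theorems.KPlusLogSqLaw.StaticTridiagonalReal (det_ctPath)

/-! ### §1 The potential dominates the letter count -/

/-- `#q(w) ≤ Θ(w)`: the constant labeling `q` has no changes. -/
theorem count_le_theta (w : List Bool) (c : Bool) : w.count c ≤ theta w := by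
  classical
  unfold theta
  refine le_trans ?_ (Finset.le_sup (f := fun lab : Fin w.length → Bool =>
    (Finset.univ.filter fun i : Fin w.length => w.get i = lab i).card -
      (Finset.univ.filter fun i : Fin w.length => ∃ h : (i : ℕ) + 1 < w.length, lab i ≠ lab ⟨(i : ℕ) + 1, h⟩).card)
    (Finset.mem_univ (fun _ => c)))
  have h0 : (Finset.univ.filter fun i : Fin w.length => ∃ _ : (i : ℕ) + 1 < w.length, c ≠ c).card = 0 := by
    simp
  have h1 : (Finset.univ.filter fun i : Fin w.length => w.get i = c).card = w.count c := by
    have := Fin.card_filter_univ_eq_vector_get_eq_count c (⟨w, rfl⟩ : List.Vector Bool w.length)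
    simpa [List.Vector.get] using this
  change w.count c ≤ (Finset.univ.filter fun i : Fin w.length => w.get i = c).card -
    (Finset.univ.filter fun i : Fin w.length => ∃ _ : (i : ℕ) + 1 < w.length, c ≠ c).card
  rw [h0, h1, tsub_zero]

/-- `Θ([]) = 0`. -/
theorem theta_nil : theta [] = 0 := by
  unfold theta
  simp

/-! ### §2 Root words -/

/-- The number of `q`-letters of the root word is the number of positive roots of `Q` lying among the positive roots of `P · Q`,
counted with multiplicity. -/
theorem count_true_rootWord (P Q : ℝ[X]) :
    (rootWord P Q).count true = ∑ x ∈ (P * Q).roots.toFinset.filter (fun x => 0 < x), Q.rootMultiplicity x := by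
  classical
  unfold rootWord
  rw [List.count_flatMap]
  set s := (P * Q).roots.toFinset.filter (fun x => 0 < x) with hs
  have hnd : (s.sort (· ≤ ·)).Nodup := Finset.sort_nodup _ _
  rw [← List.sum_toFinset _ hnd, Finset.sort_toFinset]
  refine Finset.sum_congr rfl fun x _ => ?_
  simp [List.count_replicate]

/-- Distinct positive roots of `Q` are at most the `q`-letters of `rootWord P Q` (when `P · Q ≠ 0`). -/
theorem card_posRoots_le_count_true {P Q : ℝ[X]} (hPQ : P * Q ≠ 0) :
    (Q.roots.toFinset.filter (fun x => 0 < x)).card ≤ (rootWord P Q).count true := by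
  classical
  rw [count_true_rootWord, Finset.card_eq_sum_ones]
  have hQ : Q ≠ 0 := right_ne_zero_of_mul hPQ
  calc ∑ x ∈ Q.roots.toFinset.filter (fun x => 0 < x), (1 : ℕ)
      ≤ ∑ x ∈ Q.roots.toFinset.filter (fun x => 0 < x), Q.rootMultiplicity x := by
        refine Finset.sum_le_sum fun x hx => ?_
        rw [Finset.mem_filter, Multiset.mem_toFinset] at hx
        exact (Polynomial.rootMultiplicity_pos hQ).2 ((Polynomial.mem_roots hQ).1 hx.1)
    _ ≤ ∑ x ∈ (P * Q).roots.toFinset.filter (fun x => 0 < x), Q.rootMultiplicity x := by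
        refine Finset.sum_le_sum_of_subset_of_nonneg (fun x hx => ?_) (fun _ _ _ => Nat.zero_le _)
        rw [Finset.mem_filter, Multiset.mem_toFinset] at hx ⊢
        refine ⟨?_, hx.2⟩
        rw [Polynomial.roots_mul hPQ]
        exact Multiset.mem_add.2 (Or.inr hx.1)

/-- If `P · Q` has no positive root the root word is empty. -/
theorem rootWord_eq_nil {P Q : ℝ[X]} (h : ∀ x, 0 < x → (P * Q).eval x ≠ 0) : rootWord P Q = [] := by
  classical
  unfold rootWord
  have hs : (P * Q).roots.toFinset.filter (fun x => 0 < x) = ∅ := by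
    refine Finset.filter_false_of_mem fun x hx hxpos => ?_
    rw [Multiset.mem_toFinset] at hx
    exact h x hxpos ((Polynomial.mem_roots'.1 hx).2)
  rw [hs]
  simp

/-- Distinct positive roots of a product are at most those of the factors together. -/
theorem card_posRoots_mul_le (P Q : ℝ[X]) :
    ((P * Q).roots.toFinset.filter (fun x => 0 < x)).card ≤
      (P.roots.toFinset.filter (fun x => 0 < x)).card + (Q.roots.toFinset.filter (fun x => 0 < x)).card := by
  classical
  by_cases hPQ : P * Q = 0
  · rw [hPQ, Polynomial.roots_zero]
    simp
  · rw [Polynomial.roots_mul hPQ, Multiset.toFinset_add, Finset.filter_union]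
    exact Finset.card_union_le _ _

/-! ### §3 The continuant currency: recurrence, splitting at a zero link, no common positive zero of consecutive continuants -/

section Continuant

variable {R : Type*} [CommRing R]

/-- **Splitting of a continuant at a vanishing link product**: if `M t · M' (t+1) = 0` then
`K_{t+1+n} = K_{t+1} · K_n(data shifted by t+1)`. [folklore: block-diagonal continuants] -/
theorem ctK_mul_shift (L M M' : ℕ → R) (t : ℕ) (h : M t * M' (t + 1) = 0) :
    ∀ n : ℕ, ctK L M M' (t + 1 + n) =
      ctK L M M' (t + 1) * ctK (fun s => L (s + (t + 1))) (fun s => M (s + (t + 1))) (fun s => M' (s + (t + 1))) n := by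
  intro n
  induction n using Nat.strong_induction_on with
  | _ n ih =>
    rcases n with _ | _ | n
    · simp
    · rw [show t + 1 + (0 + 1) = t + 2 by ring, ctK_add_two, ctK_one, h]
      ring_nf
    · have e1 := ih (n + 1) (by omega)
      have e0 := ih n (by omega)
      rw [show t + 1 + (n + 1 + 1) = (t + 1 + n) + 2 by ring, ctK_add_two, ctK_add_two,
        show t + 1 + n + 1 = t + 1 + (n + 1) by ring, e1, e0,
        show n + 1 + (t + 1) = t + 1 + (n + 1) by ring, show n + (t + 1) = t + 1 + n by ring]
      ring

end Continuant

variable (a : ℕ → ℝ) (d : ℕ → ℕ) (b : ℕ → ℝ) (f : ℕ → ℕ)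

/-- `D₀ = 1`. [folklore] -/
theorem pathDet_zero : pathDet a d b f 0 = 1 := Matrix.det_isEmpty

/-- `D₁ = a₀ X^{d₀}`. [folklore] -/
theorem pathDet_one : pathDet a d b f 1 = C (a 0) * X ^ d 0 := by
  unfold pathDet
  rw [det_ctPath _ _ _ 1, ctK_one]

/-- **Three-term recurrence** `D_{n+2} = a_{n+1} X^{d_{n+1}} · D_{n+1} − (b_n X^{f_n})² · D_n`. [folklore: continuants, via `det_ctPath`] -/
theorem pathDet_add_two (n : ℕ) :
    pathDet a d b f (n + 2) = (C (a (n + 1)) * X ^ d (n + 1)) * pathDet a d b f (n + 1) - (C (b n) * X ^ f n) ^ 2 * pathDet a d b f n := by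
  unfold pathDet
  rw [det_ctPath _ _ _ (n + 2), det_ctPath _ _ _ (n + 1), det_ctPath _ _ _ n, ctK_add_two]
  simp only [Nat.add_sub_cancel]
  ring

/-- The continuant `D_n` only reads the diagonal data below `n` and the link data below `n − 1`. [folklore] -/
theorem pathDet_congr {a a' : ℕ → ℝ} {d d' : ℕ → ℕ} {b b' : ℕ → ℝ} {f f' : ℕ → ℕ} {n : ℕ}
    (ha : ∀ t, t < n → a t = a' t) (hd : ∀ t, t < n → d t = d' t)
    (hb : ∀ t, t + 1 < n → b t = b' t) (hf : ∀ t, t + 1 < n → f t = f' t) :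
    pathDet a d b f n = pathDet a' d' b' f' n := by
  unfold pathDet
  congr 1
  ext x y
  simp only [ctPath_apply]
  split_ifs with h1 h2 h3
  · rw [ha x x.isLt, hd x x.isLt]
  · rw [hb x (by omega), hf x (by omega)]
  · rw [hb (x - 1) (by omega), hf (x - 1) (by omega)]
  · rfl

/-- **Splitting at a zero link**: if `b t = 0` then `D_{t+1+n} = D_{t+1} · D⁺_n`, where `D⁺` is the continuant of the design shifted
by `t + 1` (the matrix is block diagonal). [folklore] -/
theorem pathDet_split {t : ℕ} (ht : b t = 0) (n : ℕ) :
    pathDet a d b f (t + 1 + n) = pathDet a d b f (t + 1) *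
      pathDet (fun s => a (s + (t + 1))) (fun s => d (s + (t + 1))) (fun s => b (s + (t + 1))) (fun s => f (s + (t + 1))) n := by
  unfold pathDet
  rw [det_ctPath _ _ _ (t + 1 + n), det_ctPath _ _ _ (t + 1), det_ctPath _ _ _ n,
    ctK_mul_shift _ _ _ t (by simp [ht]) n]
  congr 1
  refine ctK_congr n (fun s _ => rfl) (fun s _ => rfl) (fun s h1 _ => ?_)
  simp only
  rw [show s + (t + 1) - 1 = s - 1 + (t + 1) by omega]

/-- **Consecutive continuants of a design with NONZERO links share no positive zero**: `D_k(x) = D_{k+1}(x) = 0` with `x > 0` would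
propagate down the recurrence to `D₀ = 1`. [folklore] -/
theorem eval_pathDet_succ_ne_zero (hb : ∀ t, b t ≠ 0) {x : ℝ} (hx : 0 < x) :
    ∀ k : ℕ, (pathDet a d b f k).eval x = 0 → (pathDet a d b f (k + 1)).eval x ≠ 0 := by
  intro k
  induction k with
  | zero => intro h; simp [pathDet_zero] at h
  | succ k ih =>
    intro hk1 hk2
    rw [pathDet_add_two] at hk2
    simp only [eval_sub, eval_mul, eval_pow, eval_C, eval_X, hk1, mul_zero, zero_sub, neg_eq_zero] at hk2
    rcases mul_eq_zero.1 hk2 with h | h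
    · exact absurd h (pow_ne_zero _ (mul_ne_zero (hb k) (pow_ne_zero _ hx.ne')))
    · exact ih h hk1

/-- The first root word is empty: `D₀ · D₁ = a₀ X^{d₀}` has no positive zero (`a₀ ≠ 0`). -/
theorem rootWord_zero_one (ha : ∀ t, 0 < a t) : rootWord (pathDet a d b f 0) (pathDet a d b f 1) = [] := by
  refine rootWord_eq_nil fun x hx => ?_
  rw [pathDet_zero, pathDet_one, one_mul, eval_mul, eval_C, eval_pow, eval_X]
  exact mul_ne_zero (ha 0).ne' (pow_ne_zero _ hx.ne')

/-- **The potential chain under the steps of (P)**: if `(P)_j` holds for every `j + 2 ≤ N`, then `Θ(rootWord D_k D_{k+1}) ≤ 2k` for every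
`k + 1 ≤ N`, for a definite design with nonzero links. -/
theorem theta_rootWord_le (N : ℕ) (hP : ∀ j, j + 2 ≤ N → PotentialStep j) (ha : ∀ t, 0 < a t) (hb : ∀ t, b t ≠ 0) :
    ∀ k : ℕ, k + 1 ≤ N → theta (rootWord (pathDet a d b f k) (pathDet a d b f (k + 1))) ≤ 2 * k := by
  intro k
  induction k with
  | zero => intro _; rw [rootWord_zero_one a d b f ha, theta_nil]
  | succ k ih => intro hk; exact (hP k (by omega) a d b f ha hb).trans (by have := ih (by omega); omega)

/-- **The row for designs with nonzero links** (under the steps `(P)_j`, `j + 2 ≤ m + 1`): `card posRoots(D_{m+1}) ≤ 2m`. -/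
theorem card_posRoots_pathDet_succ_le_of_links (m : ℕ) (hP : ∀ j, j + 2 ≤ m + 1 → PotentialStep j)
    (ha : ∀ t, 0 < a t) (hb : ∀ t, b t ≠ 0) :
    ((pathDet a d b f (m + 1)).roots.toFinset.filter (fun x => 0 < x)).card ≤ 2 * m := by
  classical
  by_cases hprod : pathDet a d b f m * pathDet a d b f (m + 1) = 0
  · -- degenerate: one of the two last continuants vanishes identically ⇒ `D_{m+1}` has no positive zero at all
    have hempty : (pathDet a d b f (m + 1)).roots.toFinset.filter (fun x => 0 < x) = ∅ := by
      refine Finset.filter_false_of_mem fun x hx hxpos => ?_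
      rw [Multiset.mem_toFinset] at hx
      have hroot := (Polynomial.mem_roots'.1 hx)
      rcases mul_eq_zero.1 hprod with hm | hm1
      · -- `D_m ≡ 0`: then `m ≥ 2` and `D_{m+1} = −(b X^f)² D_{m−1}`, so `x` is a common positive zero of `D_{m−1}` and `D_m ≡ 0`
        rcases m with _ | _ | m
        · simp [pathDet_zero] at hm
        · rw [pathDet_one] at hm
          exact absurd (leadingCoeff_eq_zero.2 hm) (by
            rw [leadingCoeff_mul, leadingCoeff_C, leadingCoeff_X_pow, mul_one]; exact (ha 0).ne')
        · have h2 := hroot.2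
          rw [IsRoot.def, pathDet_add_two, hm] at h2
          simp only [mul_zero, zero_sub, eval_neg, neg_eq_zero, eval_mul, eval_pow, eval_C, eval_X] at h2
          rcases mul_eq_zero.1 h2 with h | h
          · exact absurd h (pow_ne_zero _ (mul_ne_zero (hb (m + 1)) (pow_ne_zero _ hxpos.ne')))
          · exact eval_pathDet_succ_ne_zero a d b f hb hxpos (m + 1) h (by rw [hm, eval_zero])
      · exact hroot.1 hm1
    rw [hempty, Finset.card_empty]
    exact Nat.zero_le _
  · calc ((pathDet a d b f (m + 1)).roots.toFinset.filter (fun x => 0 < x)).card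
        ≤ (rootWord (pathDet a d b f m) (pathDet a d b f (m + 1))).count true := card_posRoots_le_count_true hprod
      _ ≤ theta (rootWord (pathDet a d b f m) (pathDet a d b f (m + 1))) := count_le_theta _ _
      _ ≤ 2 * m := theta_rootWord_le a d b f (m + 1) hP ha hb m le_rfl

/-! ### §4 The conditional row: all sizes, all static definite tridiagonal designs -/

/-- **CONDITIONAL UPPER ROW in the continuant currency**: under the steps `(P)_j` (`j + 2 ≤ n`), every static DEFINITE symmetric
tridiagonal monomial design of size `n` (zero links allowed) has at most `2n − 2` distinct positive determinant zeros.  Strong induction on the size: a zero link splits the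
continuant into two shorter ones (`pathDet_split`); with all links nonzero the potential chain applies. -/
theorem card_posRoots_pathDet_le :
    ∀ (n : ℕ), (∀ j, j + 2 ≤ n → PotentialStep j) → ∀ (a : ℕ → ℝ) (d : ℕ → ℕ) (b : ℕ → ℝ) (f : ℕ → ℕ), (∀ t, 0 < a t) →
      ((pathDet a d b f n).roots.toFinset.filter (fun x => 0 < x)).card ≤ 2 * n - 2 := by
  classical
  intro n
  induction n using Nat.strong_induction_on with
  | _ n ih =>
    intro hP a d b f ha
    rcases n with _ | m
    · simp [pathDet_zero]
    · by_cases hzero : ∃ t, t + 1 < m + 1 ∧ b t = 0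
      · obtain ⟨t, ht, hbt⟩ := hzero
        obtain ⟨n', hn'⟩ : ∃ n', m + 1 = t + 1 + n' := ⟨m - t, by omega⟩
        have h1 := ih (t + 1) (by omega) (fun j hj => hP j (by omega)) a d b f ha
        have h2 := ih n' (by omega) (fun j hj => hP j (by omega)) (fun s => a (s + (t + 1))) (fun s => d (s + (t + 1)))
          (fun s => b (s + (t + 1))) (fun s => f (s + (t + 1))) (fun s => ha _)
        rw [hn', pathDet_split a d b f hbt n']
        refine (card_posRoots_mul_le _ _).trans ?_
        omega
      · push Not at hzero
        have hb'ne : ∀ t, (if t + 1 < m + 1 then b t else (1 : ℝ)) ≠ 0 := by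
          intro t
          split_ifs with h
          · exact hzero t h
          · exact one_ne_zero
        rw [pathDet_congr (a := a) (a' := a) (d := d) (d' := d) (b := b) (b' := fun t => if t + 1 < m + 1 then b t else 1)
          (f := f) (f' := f) (n := m + 1) (fun _ _ => rfl) (fun _ _ => rfl)
          (fun t ht => by rw [if_pos ht]) (fun _ _ => rfl)]
        exact (card_posRoots_pathDet_succ_le_of_links a d (fun t => if t + 1 < m + 1 then b t else 1) f m hP ha hb'ne).trans
          (by omega)

/-- **A static symmetric tridiagonal monomial matrix in the typed currency of the α target** (`c`, `e` symmetric, `c = 0` off the band)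
**IS the path matrix** of its diagonal data `c t t · X^{e t t}` and link data `c t (t+1) · X^{e t (t+1)}` (extended by `1`, `0` beyond
the size), so its determinant is `pathDet`. [bookkeeping] -/
theorem det_of_eq_pathDet {m : ℕ} (c : Fin m → Fin m → ℝ) (e : Fin m → Fin m → ℕ)
    (hc : ∀ i j, c i j = c j i) (he : ∀ i j, e i j = e j i)
    (hband : ∀ i j : Fin m, (i : ℕ) + 1 < j ∨ (j : ℕ) + 1 < i → c i j = 0) :
    (Matrix.of fun i j : Fin m => C (c i j) * (X : ℝ[X]) ^ e i j).det =
      pathDet (fun t => if h : t < m then c ⟨t, h⟩ ⟨t, h⟩ else 1) (fun t => if h : t < m then e ⟨t, h⟩ ⟨t, h⟩ else 0)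
        (fun t => if h : t + 1 < m then c ⟨t, by omega⟩ ⟨t + 1, h⟩ else 1)
        (fun t => if h : t + 1 < m then e ⟨t, by omega⟩ ⟨t + 1, h⟩ else 0) m := by
  unfold pathDet
  congr 1
  refine Matrix.ext fun i j => ?_
  simp only [Matrix.of_apply, ctPath_apply]
  have hi := i.isLt
  have hj := j.isLt
  by_cases h1 : (j : ℕ) = i
  · rw [if_pos h1]
    have hji : j = i := Fin.ext h1
    subst hji
    simp only [dif_pos hj, Fin.eta]
  · rw [if_neg h1]
    by_cases h2 : (j : ℕ) = i + 1
    · rw [if_pos h2]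
      have h' : (i : ℕ) + 1 < m := h2 ▸ hj
      have hji : j = ⟨(i : ℕ) + 1, h'⟩ := Fin.ext h2
      subst hji
      simp only [dif_pos h', Fin.eta]
    · rw [if_neg h2]
      by_cases h3 : (i : ℕ) = j + 1
      · rw [if_pos h3]
        have h' : (i : ℕ) - 1 + 1 < m := by omega
        simp only [dif_pos h']
        have hji : (⟨(i : ℕ) - 1, by omega⟩ : Fin m) = j := Fin.ext (by simp only; omega)
        have hij : (⟨(i : ℕ) - 1 + 1, h'⟩ : Fin m) = i := Fin.ext (by simp only; omega)
        rw [hji, hij, hc i j, he i j]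
      · rw [if_neg h3, hband i j (by omega), C_0, zero_mul]

/-- **BOUNDED CONDITIONAL ROW**: the steps `(P)_j` with `j + 2 ≤ m` already give `card posRoots ≤ 2m − 2` for every static definite
symmetric tridiagonal `m × m` monomial matrix in the typed currency (so each kernel instance `PotentialStep j` is a rung). [this file] -/
theorem card_posRoots_le_of_potentialSteps (m : ℕ) (hP : ∀ j, j + 2 ≤ m → PotentialStep j)
    (c : Fin m → Fin m → ℝ) (e : Fin m → Fin m → ℕ) (hc : ∀ i j, c i j = c j i) (he : ∀ i j, e i j = e j i)
    (hband : ∀ i j : Fin m, (i : ℕ) + 1 < j ∨ (j : ℕ) + 1 < i → c i j = 0) (hpos : ∀ i, 0 < c i i) :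
    ((Matrix.det (Matrix.of fun i j => C (c i j) * (X : ℝ[X]) ^ e i j)).roots.toFinset.filter
      (fun t : ℝ => 0 < t)).card ≤ 2 * m - 2 := by
  rw [det_of_eq_pathDet c e hc he hband]
  refine card_posRoots_pathDet_le m hP _ _ _ _ fun t => ?_
  by_cases h : t < m
  · rw [dif_pos h]; exact hpos _
  · rw [dif_neg h]; exact one_pos

/-- **CONDITIONAL UPPER ROW (the desk's words «(P) ⇒ B m ≤ 2m − 2», R2278): under CONJECTURE (P), every static DEFINITE symmetric
tridiagonal monomial matrix — in the typed currency of the α target of record `staticTridiagonal_definite_posRoots_le` (R2102/R2114: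
`c`, `e` symmetric, `c = 0` off the band, `0 < c i i`) — has at most `2m − 2` distinct positive determinant zeros.**  With lift-p1 g12's
kernel ladder (`threeHalves_le_slope`) the α register then reads `3m/2 − O(1) ≤ B m ≤ 2m − 2` conditionally on (P); the located
pump-and-harvest family reaches `2m − 6`.  NOTHING here proves (P). [this file; conditional on the cell's conjecture (P)] -/
theorem card_posRoots_le_of_potentialLawP (hP : PotentialLawP) (m : ℕ) (c : Fin m → Fin m → ℝ) (e : Fin m → Fin m → ℕ)
    (hc : ∀ i j, c i j = c j i) (he : ∀ i j, e i j = e j i)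
    (hband : ∀ i j : Fin m, (i : ℕ) + 1 < j ∨ (j : ℕ) + 1 < i → c i j = 0) (hpos : ∀ i, 0 < c i i) :
    ((Matrix.det (Matrix.of fun i j => C (c i j) * (X : ℝ[X]) ^ e i j)).roots.toFinset.filter
      (fun t : ℝ => 0 < t)).card ≤ 2 * m - 2 :=
  card_posRoots_le_of_potentialSteps m (fun j _ => hP j) c e hc he hband hpos

/-- The same, in the shape of an ADMISSIBLE LAW `B` (the hypothesis of lift-p1's `threeHalves_le_of_definiteRow_odd` /
`threeHalves_le_slope`): under (P) the law `B m = 2m − 2` is admissible on the whole static definite tridiagonal sector. [corollary] -/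
theorem definiteRow_two_mul_sub_two_of_potentialLawP (hP : PotentialLawP) :
    ∀ (m : ℕ) (c : Fin m → Fin m → ℝ) (e : Fin m → Fin m → ℕ), (∀ i j, c i j = c j i) → (∀ i j, e i j = e j i) →
      (∀ i j : Fin m, (i : ℕ) + 1 < j ∨ (j : ℕ) + 1 < i → c i j = 0) → (∀ i, 0 < c i i) →
      ((Matrix.det (Matrix.of fun i j => C (c i j) * (X : ℝ[X]) ^ e i j)).roots.toFinset.filter
        (fun t : ℝ => 0 < t)).card ≤ (fun m => 2 * m - 2) m :=
  fun m c e hc he hband hpos => card_posRoots_le_of_potentialLawP hP m c e hc he hband hpos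

end StaticTridiagonalRealPotential

end Summit.ValiantsHypothesis.ValiantsHypothesis.Theorems.KPlusLogSqLaw
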